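import Summits.BirchSwinnertonDyer.Rank2.CertifiedPartnerTypeBNeighbour
import Summits.BirchSwinnertonDyer.Rank2.TwoAdicLambdaTransportTwoTorsionFacts
import Literature.NumberTheory.EllipticCurves.LambdaInvariantCongruenceTransportAtTwo
import Literature.NumberTheory.EllipticCurves.ManinConstantQuadraticTwistAtTwoOrdinaryProofs
import HarnessLib

/-!
# Certified partners of Greenberg type B, II: every type-B curve has a partner in the family (cell `bsd-rank2`)

Cell `bsd-rank2` (D-0036), seat `bsd-rank2-lit` GEN 18, for the E1 line `refreduction` of route
`EisensteinDepletionAtTwo` (item `DepletedLambdaLawAtTwo`, planner p2 GEN 16): the CONSTRUCTIVE half of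
its stub `stub_certifiedPartner`, in TYPE B («odd, not ramified at `2`»). Companion of
`Rank2/CertifiedPartnerTypeBModel.lean` (the family `W′_k = ⟨1, −12k−7, 0, (6k+3)², 0⟩`: globally minimal,
elliptic, good ordinary at `2`) and `Rank2/CertifiedPartnerTypeBNeighbour.lean` (its full-`2`-torsion neighbour
`W″_k = ⟨1, 24k+11, 0, −(18k+9), 0⟩ ~ W′_k`). Memo: `run/shared/lean/pub/bsd-rank2/lit/g17/E1-partner-families.md`.

PARTITION: none — r_an ≥ 2, summit axis S0; TWIN (D-0056): n/a. B1: explicit-model algebra (`2`-division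
cubic, discriminants, residues mod `8`); no `L`-function, no Selmer group, no S0 motion.

## Statements

* `(0,0)` is a rational point of order `2` on `W′_k`; the other two `2`-torsion abscissae are the roots of
  `4X² − (48k+27)X + 4(6k+3)²`, of discriminant `9·(32k+17)`: so `(0,0)` is the UNIQUE rational point of
  order `2` as soon as `32k+17` is not a square (`hasUniqueRationalTwoTorsionX_partnerB`), it is ODD
  (least real abscissa; `twoTorsionOdd_partnerB`) and NOT RAMIFIED at `2` (`x = 0`): TYPE B.
* For EVERY globally minimal `W`, good ordinary at `2`, with a unique rational `2`-torsion abscissa `x`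
  of type B, there is `k` with `IsSquare (Δ(W)·Δ(W′_k))` and `32k+17` not a square
  (`exists_partnerB`, and `exists_certifiedPartner_typeB` in the ∃-shape of `stub_certifiedPartner`
  minus its analytic conjuncts): with `δ = b₂² − 8b₂x − 48x² − 32b₄` one has
  `4·Δ(W) = δ·(6x² + b₂x + b₄)²` (`four_mul_Δ_eq_of_twoDivision_root`), `δ·den(x)² ≡ 1 (mod 8)` (`a₁`
  odd because `W` is ordinary at `2`, tree lemma `odd_a₁_of_hasGoodReductionAtPrime_two_of_odd_frobeniusTrace_two`;
  `den(x)` odd because `x` is not ramified), hence `δ·den(x)²·β² = 32k + 17` for some odd `β ≤ 7`; and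
  `δ` is not a square, else the quadratic cofactor of `X − x` in the `2`-division cubic would have a
  rational root, a second rational `2`-torsion abscissa.
* `W″_k` has the three rational `2`-torsion abscissae `0`, `3/4`, `−24k−12` and the Prop-5.14 point
  `(3/4, −3/8)` (ramified at `2`, not odd); with `Rank2/CertifiedPartnerTypeBNeighbour.lean` this is the «`W″`
  block» of `stub_partnerCF`, and `exists_partnerCF_typeB` is that stub's conclusion VERBATIM for type-B input.

No named fact, no `sorry`.
-/

namespace Summit.BirchSwinnertonDyer.Rank2

open _root_.WeierstrassCurve
open Literature.NumberTheory.EllipticCurves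
open Literature.NumberTheory.EllipticCurves.Greenberg1999

section PartnerTypeB

/-! ### The rational point `(0,0)` of order `2`: unique, odd, not ramified -/

/-- A rational root of the `2`-division cubic `4X³ + b₂X² + 2b₄X + b₆` is the abscissa of a rational
point of order `2` (with `y = −(a₁z + a₃)/2`). Converse of the tree's
`fourXCubed_add_eq_zero_of_twoTorsion`. [cite: SilvermanAEC2009, III.2.3 (b) (ψ₂)] -/
theorem hasRationalTwoTorsionX_of_twoDivision_root {W : WeierstrassCurve ℚ} {z : ℚ}
    (h : 4 * z ^ 3 + W.b₂ * z ^ 2 + 2 * W.b₄ * z + W.b₆ = 0) : HasRationalTwoTorsionX W z := by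
  refine ⟨-(W.a₁ * z + W.a₃) / 2, ?_, by ring⟩
  rw [WeierstrassCurve.Affine.equation_iff]
  simp only [WeierstrassCurve.b₂, WeierstrassCurve.b₄, WeierstrassCurve.b₆] at h
  linear_combination (-(1 : ℚ) / 4) * h

/-- `(0, 0)` is a rational point of order `2` on `W′_k`. [folklore] -/
theorem hasRationalTwoTorsionX_partnerB_zero (k : ℤ) :
    HasRationalTwoTorsionX
      (⟨1, ((-12 * k - 7 : ℤ) : ℚ), 0, (((6 * k + 3) ^ 2 : ℤ) : ℚ), 0⟩ : WeierstrassCurve ℚ) 0 :=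
  ⟨0, by rw [WeierstrassCurve.Affine.equation_iff]; simp, by simp⟩

/-- **`(0,0)` is the UNIQUE rational point of order `2` on `W′_k` when `32k + 17` is not a square**:
another abscissa `z ≠ 0` satisfies `4z² − (48k+27)z + 4(6k+3)² = 0`, whose discriminant is `9(32k+17)`.
[folklore] -/
theorem hasUniqueRationalTwoTorsionX_partnerB (k : ℤ) (hns : ¬ IsSquare ((32 * k + 17 : ℤ) : ℚ)) :
    HasUniqueRationalTwoTorsionX
      (⟨1, ((-12 * k - 7 : ℤ) : ℚ), 0, (((6 * k + 3) ^ 2 : ℤ) : ℚ), 0⟩ : WeierstrassCurve ℚ) 0 := by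
  refine ⟨hasRationalTwoTorsionX_partnerB_zero k, fun z hz ↦ ?_⟩
  obtain ⟨y, hy, h2⟩ := hz
  have hc := fourXCubed_add_eq_zero_of_twoTorsion hy h2
  simp only [WeierstrassCurve.b₂, WeierstrassCurve.b₄, WeierstrassCurve.b₆] at hc
  push_cast at hc
  by_contra hz0
  have hq : z * (4 * z ^ 2 - (48 * k + 27) * z + 4 * (6 * k + 3) ^ 2) = 0 := by
    linear_combination hc
  have hq' : 4 * z ^ 2 - (48 * k + 27) * z + 4 * (6 * k + 3) ^ 2 = 0 :=
    (mul_eq_zero.mp hq).resolve_left hz0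
  refine hns ⟨(8 * z - (48 * k + 27)) / 3, ?_⟩
  push_cast
  linear_combination (-(16 : ℚ) / 9) * hq'

/-- **`(0,0)` is ODD on `W′_k`**: `0` is the least real root of the `2`-division cubic
`X·(4X² − (48k+27)X + 4(6k+3)²)` (for `k ≥ 0` the quadratic factor is positive on `X < 0`; for
`k ≤ −1` it has no real root, its discriminant `9(32k+17)` being negative). [folklore] -/
theorem twoTorsionOdd_partnerB (k : ℤ) :
    TwoTorsionOdd
      (⟨1, ((-12 * k - 7 : ℤ) : ℚ), 0, (((6 * k + 3) ^ 2 : ℤ) : ℚ), 0⟩ : WeierstrassCurve ℚ) 0 := by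
  intro r hr
  simp only [WeierstrassCurve.b₂, WeierstrassCurve.b₄, WeierstrassCurve.b₆] at hr
  push_cast at hr ⊢
  by_contra hneg
  push Not at hneg
  have hq : r * (4 * r ^ 2 - (48 * k + 27) * r + 4 * (6 * k + 3) ^ 2) = 0 := by
    linear_combination hr
  have hq' : 4 * r ^ 2 - (48 * (k : ℝ) + 27) * r + 4 * (6 * k + 3) ^ 2 = 0 :=
    (mul_eq_zero.mp hq).resolve_left hneg.ne
  rcases le_or_gt 0 k with hk | hk
  · have hk' : (0 : ℝ) ≤ k := by exact_mod_cast hk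
    nlinarith [sq_nonneg (6 * (k : ℝ) + 3), mul_pos (by linarith : (0 : ℝ) < 48 * k + 27)
      (neg_pos.mpr hneg)]
  · have hk' : (k : ℝ) ≤ -1 := by exact_mod_cast (show k ≤ -1 by omega)
    nlinarith [sq_nonneg (8 * r - (48 * (k : ℝ) + 27))]

/-! ### The neighbour `W″_k`: full rational `2`-torsion and the Prop-5.14 point `(3/4, −3/8)` -/

/-- `x = 0`, `x = 3/4` and `x = −24k − 12` are rational `2`-torsion abscissae of `W″_k`
(`4X³ + b₂X² + 2b₄X = X(4X − 3)(X + 24k + 12)`). [folklore] -/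
theorem hasRationalTwoTorsionX_neighbourB (k : ℤ) :
    HasRationalTwoTorsionX (⟨1, ((24 * k + 11 : ℤ) : ℚ), 0, ((-(18 * k + 9) : ℤ) : ℚ), 0⟩ : WeierstrassCurve ℚ) 0 ∧
      HasRationalTwoTorsionX (⟨1, ((24 * k + 11 : ℤ) : ℚ), 0, ((-(18 * k + 9) : ℤ) : ℚ), 0⟩ : WeierstrassCurve ℚ)
        (3 / 4) ∧
      HasRationalTwoTorsionX (⟨1, ((24 * k + 11 : ℤ) : ℚ), 0, ((-(18 * k + 9) : ℤ) : ℚ), 0⟩ : WeierstrassCurve ℚ)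
        (-24 * k - 12) := by
  refine ⟨⟨0, ?_, by simp⟩, ⟨-3 / 8, ?_, by norm_num⟩, ⟨12 * k + 6, ?_, by push_cast; ring⟩⟩ <;>
    rw [WeierstrassCurve.Affine.equation_iff] <;> push_cast <;> ring

/-- `x₀ = 3/4` is RAMIFIED at `2` (`v₂(3/4) = −2`). [cite: GreenbergLNM1716, §5 (chunk p0168)] -/
theorem twoTorsionRamifiedAtTwo_three_quarters : TwoTorsionRamifiedAtTwo (3 / 4) := by
  rw [twoTorsionRamifiedAtTwo_iff]
  haveI : Fact (Nat.Prime 2) := ⟨Nat.prime_two⟩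
  rw [padicValRat.div (by norm_num) (by norm_num), show (3 : ℚ) = ((3 : ℤ) : ℚ) by norm_num,
    padicValRat.of_int, show (4 : ℚ) = ((4 : ℕ) : ℚ) by norm_num, padicValRat.of_nat,
    padicValInt.eq_zero_of_not_dvd (by norm_num), show (4 : ℕ) = 2 ^ 2 by norm_num, padicValNat.prime_pow]
  norm_num

/-- `x₀ = 3/4` is NOT odd on `W″_k`: `0` is a smaller real root of the `2`-division cubic.
[cite: GreenbergLNM1716, §5 Remark (chunk p0174)] -/
theorem not_twoTorsionOdd_neighbourB_three_quarters (k : ℤ) :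
    ¬ TwoTorsionOdd (⟨1, ((24 * k + 11 : ℤ) : ℚ), 0, ((-(18 * k + 9) : ℤ) : ℚ), 0⟩ : WeierstrassCurve ℚ)
      (3 / 4) := by
  intro h
  have h0 := h 0 (by simp [WeierstrassCurve.b₆])
  push_cast at h0
  linarith

/-- **The «`W″` block» of `stub_partnerCF` for the family**: `W″_k` is elliptic, globally minimal, isogenous
to `W′_k`, good ordinary at `2`, has the Prop-5.14 point `(3/4, −3/8)` (ramified, not odd) and three distinct
rational `2`-torsion abscissae. [folklore] -/
theorem neighbourB_block (k : ℤ) :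
    ∃ (W'' : WeierstrassCurve ℚ) (_ : W''.IsElliptic) (_ : W''.IsGloballyMinimal),
      WeierstrassCurve.IsIsogenous W''
          (⟨1, ((-12 * k - 7 : ℤ) : ℚ), 0, (((6 * k + 3) ^ 2 : ℤ) : ℚ), 0⟩ : WeierstrassCurve ℚ) ∧
        IsOrdinaryAt W'' 2 ∧
        (∃ x₀ y₀ : ℚ, W''.toAffine.Equation x₀ y₀ ∧ 2 * y₀ + W''.a₁ * x₀ + W''.a₃ = 0 ∧
          ((TwoTorsionRamifiedAtTwo x₀ ∧ ¬ TwoTorsionOdd W'' x₀) ∨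
            (TwoTorsionOdd W'' x₀ ∧ ¬ TwoTorsionRamifiedAtTwo x₀))) ∧
        (∃ x₁ x₂ x₃ : ℚ, x₁ ≠ x₂ ∧ x₁ ≠ x₃ ∧ x₂ ≠ x₃ ∧ HasRationalTwoTorsionX W'' x₁ ∧
          HasRationalTwoTorsionX W'' x₂ ∧ HasRationalTwoTorsionX W'' x₃) := by
  obtain ⟨h0, h34, hneg⟩ := hasRationalTwoTorsionX_neighbourB k
  obtain ⟨y₀, hy₀, h2y₀⟩ := h34
  refine ⟨_, isElliptic_neighbourB k, isGloballyMinimal_neighbourB k, isIsogenous_neighbourB_partnerB k,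
    isOrdinaryAt_two_neighbourB k,
    ⟨3 / 4, y₀, hy₀, h2y₀, Or.inl ⟨twoTorsionRamifiedAtTwo_three_quarters,
      not_twoTorsionOdd_neighbourB_three_quarters k⟩⟩,
    ⟨0, 3 / 4, -24 * k - 12, by norm_num, ?_, ?_, h0, ⟨y₀, hy₀, h2y₀⟩, hneg⟩⟩
  · have : Odd (-24 * k - 12 - 1 : ℤ) := ⟨-12 * k - 7, by ring⟩
    intro h
    have h' : ((-24 * k - 12 : ℤ) : ℚ) = 0 := by push_cast; linarith
    have : (-24 * k - 12 : ℤ) = 0 := by exact_mod_cast h'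
    omega
  · intro h
    have h' : (4 * (-24 * k - 12) : ℚ) = 3 := by linarith
    have h'' : ((4 * (-24 * k - 12) : ℤ) : ℚ) = ((3 : ℤ) : ℚ) := by push_cast; linarith
    have : (4 * (-24 * k - 12) : ℤ) = 3 := by exact_mod_cast h''
    omega

/-! ### From an arbitrary type-B curve to the family: the invariant `δ` -/

/-- **`4·Δ = δ·(6e² + b₂e + b₄)²`** for a root `e` of the `2`-division cubic, where
`δ = b₂² − 8b₂e − 48e² − 32b₄` is `16×` the discriminant of the quadratic cofactor
`X² + (e + b₂/4)X + (e² + b₂e/4 + b₄/2)` of `X − e` in the monic cubic (and `6e² + b₂e + b₄` is twice its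
value at `e`): `disc((X − e)·g) = disc(g)·g(e)²` and `Δ = 16·disc`. [folklore] -/
theorem four_mul_Δ_eq_of_twoDivision_root {F : Type*} [CommRing F] (W : WeierstrassCurve F) {e : F}
    (h : 4 * e ^ 3 + W.b₂ * e ^ 2 + 2 * W.b₄ * e + W.b₆ = 0) :
    4 * W.Δ = (W.b₂ ^ 2 - 8 * W.b₂ * e - 48 * e ^ 2 - 32 * W.b₄) * (6 * e ^ 2 + W.b₂ * e + W.b₄) ^ 2 := by
  simp only [WeierstrassCurve.Δ]
  linear_combination (-W.b₂ ^ 2) * W.b_relation +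
    (-W.b₂ ^ 3 + 36 * W.b₂ * W.b₄ + 108 * W.b₂ * e ^ 2 + 216 * W.b₄ * e - 108 * W.b₆ + 432 * e ^ 3) * h

/-- The denominator of a `2`-torsion abscissa that is NOT ramified at `2` is odd. [folklore] -/
theorem not_two_dvd_den_of_not_twoTorsionRamifiedAtTwo {x : ℚ} (h : ¬ TwoTorsionRamifiedAtTwo x) :
    ¬ 2 ∣ x.den := by
  intro h2
  apply h
  rw [TwoTorsionRamifiedAtTwo, padicValRat]
  have hnum : ¬ (2 : ℤ) ∣ x.num := by
    intro hn
    have hn' : 2 ∣ x.num.natAbs := by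
      rcases hn with ⟨c, hc⟩
      exact ⟨c.natAbs, by rw [hc, Int.natAbs_mul]; rfl⟩
    have hg : 2 ∣ Nat.gcd x.num.natAbs x.den := Nat.dvd_gcd hn' h2
    rw [x.reduced.gcd_eq_one] at hg
    omega
  haveI : Fact (Nat.Prime 2) := ⟨Nat.prime_two⟩
  rw [padicValInt.eq_zero_of_not_dvd hnum]
  have h1 : 1 ≤ padicValNat 2 x.den := one_le_padicValNat_of_dvd x.den_nz h2
  omega

/-- The square of an odd integer is `≡ 1 (mod 8)`. [folklore] -/
theorem exists_sq_eq_eight_mul_add_one {t : ℤ} (ht : Odd t) : ∃ w : ℤ, t ^ 2 = 8 * w + 1 := by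
  obtain ⟨u, rfl⟩ := ht
  obtain ⟨w, hw⟩ := Int.even_mul_succ_self u
  exact ⟨w, by linear_combination 4 * hw⟩

/-- An integer `≡ 1 (mod 8)` is `(32k + 17)/β²`-shaped: `D·β² = 32k + 17` for some `β ∈ {1,3,5,7}`.
[folklore] -/
theorem exists_mul_sq_eq_of_emod_eight {D : ℤ} (hD : D % 8 = 1) :
    ∃ β k : ℤ, β ≠ 0 ∧ D * β ^ 2 = 32 * k + 17 := by
  have h32 : D % 32 = 1 ∨ D % 32 = 9 ∨ D % 32 = 17 ∨ D % 32 = 25 := by omega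
  rcases h32 with h | h | h | h
  · exact ⟨7, (D * 49 - 17) / 32, by norm_num, by rw [show (7 : ℤ) ^ 2 = 49 by norm_num]; omega⟩
  · exact ⟨3, (D * 9 - 17) / 32, by norm_num, by rw [show (3 : ℤ) ^ 2 = 9 by norm_num]; omega⟩
  · exact ⟨1, (D - 17) / 32, by norm_num, by rw [show (1 : ℤ) ^ 2 = 1 by norm_num]; omega⟩
  · exact ⟨5, (D * 25 - 17) / 32, by norm_num, by rw [show (5 : ℤ) ^ 2 = 25 by norm_num]; omega⟩

variable (W : WeierstrassCurve ℚ) [W.IsElliptic] [W.IsGloballyMinimal]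

/-- **The type-B invariant.** For `W` globally minimal and good ordinary at `2` and a rational `x`
not ramified at `2` (`v₂(x) ≥ 0`; meant for a `2`-torsion abscissa): with `δ = b₂² − 8b₂x − 48x² − 32b₄` there are an integer
`k` and a nonzero rational `ρ` with `32k + 17 = δ·ρ²` (namely `ρ = den(x)·β`: `δ·den(x)² ≡ (b₂·den x)²
≡ 1 (mod 8)`, `b₂ = a₁² + 4a₂` being odd since `a₁` is — ordinary at `2`). [folklore] -/
theorem exists_eq_delta_mul_sq_of_typeB (hord : IsOrdinaryAt W 2) {x : ℚ}
    (hram : ¬ TwoTorsionRamifiedAtTwo x) :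
    ∃ (k : ℤ) (ρ : ℚ), ρ ≠ 0 ∧
      ((32 * k + 17 : ℤ) : ℚ) = (W.b₂ ^ 2 - 8 * W.b₂ * x - 48 * x ^ 2 - 32 * W.b₄) * ρ ^ 2 := by
  -- the integral model and the parity of `a₁`
  set M : WeierstrassCurve ℤ := integralModelInt W with hM
  have hWM : M.map (Int.castRingHom ℚ) = W := map_integralModelInt W
  have hodd2 : Odd (W.frobeniusTrace 2) :=
    Int.not_even_iff_odd.mp fun h ↦ hord.2 (by exact_mod_cast even_iff_two_dvd.mp h)
  have ha₁ : Odd M.a₁ :=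
    odd_a₁_of_hasGoodReductionAtPrime_two_of_odd_frobeniusTrace_two W hord.1 hodd2
  have hb₂odd : Odd M.b₂ := by
    rw [WeierstrassCurve.b₂]
    exact ha₁.pow.add_even ⟨2 * M.a₂, by ring⟩
  have hb₂ : W.b₂ = (M.b₂ : ℚ) := by rw [← hWM, map_b₂]; simp
  have hb₄ : W.b₄ = (M.b₄ : ℚ) := by rw [← hWM, map_b₄]; simp
  -- the abscissa `x = n / m` with `m` odd
  set n : ℤ := x.num with hn
  set m : ℕ := x.den with hm
  have hm0 : (m : ℚ) ≠ 0 := by exact_mod_cast x.den_nz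
  have hxm : x * m = n := Rat.mul_den_eq_num x
  have hmodd : Odd (m : ℤ) := by
    have := not_two_dvd_den_of_not_twoTorsionRamifiedAtTwo hram
    rcases Nat.even_or_odd m with h | h
    · exact absurd (even_iff_two_dvd.mp h) this
    · exact_mod_cast h
  -- the integer `D = δ·m²` and its residue mod 8
  set D : ℤ := M.b₂ ^ 2 * m ^ 2 - 8 * M.b₂ * n * m - 48 * n ^ 2 - 32 * M.b₄ * m ^ 2 with hD
  obtain ⟨w, hw⟩ := exists_sq_eq_eight_mul_add_one (hb₂odd.mul hmodd)
  have hD8 : D % 8 = 1 := by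
    have hX : D = 8 * (w - M.b₂ * n * m - 6 * n ^ 2 - 4 * M.b₄ * m ^ 2) + 1 := by
      rw [hD]; linear_combination hw
    obtain ⟨X, hX'⟩ : ∃ X : ℤ, D = 8 * X + 1 := ⟨_, hX⟩
    omega
  obtain ⟨β, k, hβ, hk⟩ := exists_mul_sq_eq_of_emod_eight hD8
  refine ⟨k, m * β, mul_ne_zero hm0 (by exact_mod_cast hβ), ?_⟩
  have hk' : ((32 * k + 17 : ℤ) : ℚ) = (D : ℚ) * (β : ℚ) ^ 2 := by
    rw [← hk]; push_cast; ring
  rw [hk', hD, hb₂, hb₄]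
  push_cast
  rw [← hxm]
  ring

/-- **Existence of a type-B partner in the family.** For `W` globally minimal, good ordinary at `2`, with
a UNIQUE rational point of order `2`, of abscissa `x` not ramified at `2`: there is `k : ℤ` with
`32k + 17` not a square and `Δ(W)·Δ(W′_k)` a square. (`32k+17 = δρ²`; `4Δ(W) = δ·(6x²+b₂x+b₄)²`;
`Δ(W′_k) = 9(32k+17)(6k+3)⁴`; and `δ` is not a square, else the quadratic cofactor of `X − x` would have a
rational root, a second rational `2`-torsion abscissa.) [folklore] -/
theorem exists_partnerB (hord : IsOrdinaryAt W 2) {x : ℚ} (hx : HasUniqueRationalTwoTorsionX W x)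
    (hram : ¬ TwoTorsionRamifiedAtTwo x) :
    ∃ k : ℤ, ¬ IsSquare ((32 * k + 17 : ℤ) : ℚ) ∧
      IsSquare (W.Δ *
        (⟨1, ((-12 * k - 7 : ℤ) : ℚ), 0, (((6 * k + 3) ^ 2 : ℤ) : ℚ), 0⟩ : WeierstrassCurve ℚ).Δ) := by
  obtain ⟨⟨y, hy, h2⟩, huniq⟩ := hx
  have hcub := fourXCubed_add_eq_zero_of_twoTorsion hy h2
  obtain ⟨k, ρ, hρ, hk⟩ := exists_eq_delta_mul_sq_of_typeB W hord hram
  set δ : ℚ := W.b₂ ^ 2 - 8 * W.b₂ * x - 48 * x ^ 2 - 32 * W.b₄ with hδ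
  have h4Δ := four_mul_Δ_eq_of_twoDivision_root W hcub
  refine ⟨k, ?_, ?_⟩
  · -- `32k + 17` is not a square: otherwise `δ = (4σ)²` and `(−a ± σ)/2` are two rational roots
    rintro ⟨s, hs⟩
    set σ : ℚ := s / (4 * ρ) with hσ
    have hσ' : 16 * σ ^ 2 = δ := by
      calc 16 * σ ^ 2 = (s * s) / ρ ^ 2 := by rw [hσ]; ring
        _ = δ * ρ ^ 2 / ρ ^ 2 := by rw [hs.symm.trans hk]
        _ = δ := mul_div_cancel_right₀ _ (pow_ne_zero 2 hρ)
    -- the two roots of the quadratic cofactor are `2`-torsion abscissae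
    have hroot : ∀ τ : ℚ, 16 * τ ^ 2 = δ →
        4 * ((-(x + W.b₂ / 4) + τ) / 2) ^ 3 + W.b₂ * ((-(x + W.b₂ / 4) + τ) / 2) ^ 2 +
          2 * W.b₄ * ((-(x + W.b₂ / 4) + τ) / 2) + W.b₆ = 0 := by
      intro τ hτ
      rw [hδ] at hτ
      linear_combination hcub + ((-(x + W.b₂ / 4) + τ) / 2 - x) / 16 * hτ
    have hz₁ := huniq _ (hasRationalTwoTorsionX_of_twoDivision_root (hroot σ hσ'))
    have hz₂ := huniq _ (hasRationalTwoTorsionX_of_twoDivision_root (hroot (-σ) (by rw [neg_sq]; exact hσ')))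
    have hσ0 : σ = 0 := by linarith
    have hδ0 : δ = 0 := by rw [← hσ', hσ0]; ring
    have h17 : ((32 * k + 17 : ℤ) : ℚ) = 0 := by rw [hk, hδ0, zero_mul]
    have h17' : (32 * k + 17 : ℤ) = 0 := by exact_mod_cast h17
    omega
  · -- `Δ(W)·Δ(W′_k) = (3·δ·(6x²+b₂x+b₄)·ρ·(6k+3)²/2)²`
    refine ⟨3 * δ * (6 * x ^ 2 + W.b₂ * x + W.b₄) * ρ * (6 * k + 3) ^ 2 / 2, ?_⟩
    have hΔW : W.Δ = δ * (6 * x ^ 2 + W.b₂ * x + W.b₄) ^ 2 / 4 := by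
      rw [hδ, ← h4Δ]; ring
    have hk' : (32 * (k : ℚ) + 17) = δ * ρ ^ 2 := by exact_mod_cast hk
    rw [partnerB_Δ, hΔW, hk']
    ring

/-- **Certified partner, type B — the constructive half of `stub_certifiedPartner` (E1 line
`refreduction`, item `DepletedLambdaLawAtTwo`).** For every globally minimal `W`, good ordinary at `2`,
with a unique rational point of order `2`, of abscissa `x`, ODD and NOT RAMIFIED at `2` (Greenberg type B):
there is a member `W′ = W′_k` of the explicit family, an elliptic curve, globally minimal, good ordinary at
`2`, with a unique rational point of order `2` at `x′ = 0`, of the SAME type B, and with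
`IsSquare (Δ(W)·Δ(W′))` (same `2`-division field). What `stub_certifiedPartner` asks beyond this — a
newform of `W′`, an integral multiple of its `2`-adic `L`-function, and the λ-law AT `W′` — is analytic and
is not asserted here. [folklore] -/
theorem exists_certifiedPartner_typeB (x : ℚ) (hord : IsOrdinaryAt W 2)
    (hx : HasUniqueRationalTwoTorsionX W x) (hodd : TwoTorsionOdd W x)
    (hram : ¬ TwoTorsionRamifiedAtTwo x) :
    ∃ (W' : WeierstrassCurve ℚ) (_ : W'.IsElliptic) (_ : W'.IsGloballyMinimal) (x' : ℚ),
      IsOrdinaryAt W' 2 ∧ HasUniqueRationalTwoTorsionX W' x' ∧ SameGreenbergTypeAB W x W' x' ∧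
        IsSquare (W.Δ * W'.Δ) ∧
        ∃ k : ℤ, ¬ IsSquare ((32 * k + 17 : ℤ) : ℚ) ∧ x' = 0 ∧
          W' = ⟨1, ((-12 * k - 7 : ℤ) : ℚ), 0, (((6 * k + 3) ^ 2 : ℤ) : ℚ), 0⟩ := by
  obtain ⟨k, hns, hsq⟩ := exists_partnerB W hord hx hram
  exact ⟨_, isElliptic_partnerB k, isGloballyMinimal_partnerB k, 0, isOrdinaryAt_two_partnerB k,
    hasUniqueRationalTwoTorsionX_partnerB k hns,
    Or.inr ⟨hodd, hram, twoTorsionOdd_partnerB k, Family81517.not_twoTorsionRamifiedAtTwo_zero⟩, hsq,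
    k, hns, rfl, rfl⟩

/-- **`stub_partnerCF` (E1M line `cfsplit`, crux `DepletedLambdaLawAtTwoMod`) for TYPE-B input, VERBATIM
conclusion.** For every globally minimal `W`, good ordinary at `2`, with a unique rational point of order `2`
of abscissa `x`, ODD and NOT RAMIFIED at `2`: a partner `W′` (elliptic, globally minimal, good ordinary at `2`,
unique rational `2`-torsion, same type, `IsSquare (Δ(W)·Δ(W′))`) together with a full-`2`-torsion CF-habitat
neighbour `W″ ~ W′` (elliptic, globally minimal, good ordinary at `2`, a Prop-5.14 point, three distinct rational
`2`-torsion abscissae). The type-A half of the stub is not treated in this file. [folklore] -/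
theorem exists_partnerCF_typeB (x : ℚ) (hord : IsOrdinaryAt W 2) (hx : HasUniqueRationalTwoTorsionX W x)
    (hB : TwoTorsionOdd W x ∧ ¬ TwoTorsionRamifiedAtTwo x) :
    ∃ (W' : WeierstrassCurve ℚ) (_ : W'.IsElliptic) (_ : W'.IsGloballyMinimal) (x' : ℚ),
      IsOrdinaryAt W' 2 ∧ HasUniqueRationalTwoTorsionX W' x' ∧ SameGreenbergTypeAB W x W' x' ∧
        IsSquare (W.Δ * W'.Δ) ∧
        ∃ (W'' : WeierstrassCurve ℚ) (_ : W''.IsElliptic) (_ : W''.IsGloballyMinimal),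
          WeierstrassCurve.IsIsogenous W'' W' ∧ IsOrdinaryAt W'' 2 ∧
            (∃ x₀ y₀ : ℚ, W''.toAffine.Equation x₀ y₀ ∧ 2 * y₀ + W''.a₁ * x₀ + W''.a₃ = 0 ∧
              ((TwoTorsionRamifiedAtTwo x₀ ∧ ¬ TwoTorsionOdd W'' x₀) ∨
                (TwoTorsionOdd W'' x₀ ∧ ¬ TwoTorsionRamifiedAtTwo x₀))) ∧
            (∃ x₁ x₂ x₃ : ℚ, x₁ ≠ x₂ ∧ x₁ ≠ x₃ ∧ x₂ ≠ x₃ ∧ HasRationalTwoTorsionX W'' x₁ ∧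
              HasRationalTwoTorsionX W'' x₂ ∧ HasRationalTwoTorsionX W'' x₃) := by
  obtain ⟨k, hns, hsq⟩ := exists_partnerB W hord hx hB.2
  exact ⟨_, isElliptic_partnerB k, isGloballyMinimal_partnerB k, 0, isOrdinaryAt_two_partnerB k,
    hasUniqueRationalTwoTorsionX_partnerB k hns,
    Or.inr ⟨hB.1, hB.2, twoTorsionOdd_partnerB k, Family81517.not_twoTorsionRamifiedAtTwo_zero⟩, hsq,
    neighbourB_block k⟩

end PartnerTypeB

end Summit.BirchSwinnertonDyer.Rank2
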